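import Literature.MathematicalPhysics.QuantumManyBody.PeriodicBoseGas
import Mathlib.Analysis.Calculus.ContDiff.Basic
import HarnessLib

/-!
# The periodised pair potential of a finite-range profile: nearest image and smoothness

Topic `Literature/MathematicalPhysics/QuantumManyBody`, companion of `PeriodicBoseGas.lean`
(`periodizedPotential v L x = ∑_{n ∈ ℤ³} v(|x - Ln|)`, `periodicInteraction`). For a profile `v` of
range `R₀` (`v(r) = 0` for `r > R₀`) on a torus of side `L > 2R₀`, the lattice sum is *locally a
single image*: every `x₀ ∈ ℝ³` has a neighbourhood `U` and a lattice point `n₀` with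
`v^per(x) = v(|x - Ln₀|)` for all `x ∈ U` (`eventually_periodizedPotential_eq_single`; two images
within `R₀ + δ`, `2δ = L - 2R₀`, of the same point would be lattice points at distance `< L`).
Consequences (all proved):

* `periodizedPotential_ne_top_of_range`, `periodicInteraction_ne_top_of_range` — for a finite
  profile the periodised potential and the periodic interaction are finite everywhere;
* `contDiff_toReal_periodizedPotential`, `contDiff_toReal_periodicInteraction` — if
  `x ↦ v(|x|)` is `Cᵏ` on `ℝ³` (as a real function) then so are `x ↦ v^per(x)` and
  `X ↦ ∑_{i<j} v^per(xᵢ - xⱼ)` (as real functions): the smoothness of the pair potential needed to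
  differentiate the `N`-body Schrödinger equation on the torus (LSSY's nearest-image convention
  for `R₀ < L/2`, [LSSY2005, Ch. 2, remark after (2.2)]).

Not here: anything for `L ≤ 2R₀` (several images may then overlap and corners of the support of
`v(|·|)` can destroy smoothness of the sum even for smooth `v(|·|)`).

## References
* [LSSY2005] E. H. Lieb, R. Seiringer, J. P. Solovej, J. Yngvason, *The Mathematics of the Bose Gas
  and its Condensation*, Birkhäuser 2005, Ch. 2 (2.1)–(2.2) and the remark following (2.2)
  (periodic box, interaction with the nearest image when the range is `< L/2`).
* [Fournais2020] S. Fournais, *Length scales for BEC in the dilute Bose gas*, (1.1)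
  (`v^per = ∑_j v(x - Lj)`).
-/

noncomputable section

open Filter Metric Topology
open scoped ENNReal NNReal

namespace Literature.MathematicalPhysics.QuantumManyBody.BoseGas

variable {v : ℝ → ℝ≥0∞} {R₀ L : ℝ}

/-- Distinct points of the lattice `Lℤ³` are at distance at least `L` (`L ≥ 0`). [folklore] -/
theorem le_norm_latticeVec_sub_latticeVec (hL : 0 ≤ L) {n m : Fin 3 → ℤ} (h : n ≠ m) :
    L ≤ ‖latticeVec L n - latticeVec L m‖ := by
  obtain ⟨k, hk⟩ : ∃ k, n k ≠ m k := Function.ne_iff.1 h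
  have h1 : (1 : ℝ) ≤ |((n k : ℝ) - m k)| := by
    have : (1 : ℤ) ≤ |n k - m k| := Int.one_le_abs (sub_ne_zero.2 hk)
    exact_mod_cast this
  calc L = L * 1 := (mul_one L).symm
    _ ≤ L * |((n k : ℝ) - m k)| := mul_le_mul_of_nonneg_left h1 hL
    _ = |(latticeVec L n - latticeVec L m) k| := by
        rw [show (latticeVec L n - latticeVec L m) k = L * ((n k : ℝ) - m k) by
          simp [latticeVec, mul_sub], abs_mul, abs_of_nonneg hL]
    _ ≤ ‖latticeVec L n - latticeVec L m‖ := by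
        simpa using PiLp.norm_apply_le (latticeVec L n - latticeVec L m) k

/-- **At most one near image.** With `2δ = L - 2R₀` (`L > 0`), for every `x₀ ∈ ℝ³` there is a
lattice point `n₀` such that all *other* images are far: `R₀ + δ ≤ |x₀ - Ln|` for `n ≠ n₀`.
[folklore] -/
theorem exists_forall_ne_le_norm_sub_latticeVec (hL : 0 < L) (R₀ : ℝ) (x₀ : Space) :
    ∃ n₀ : Fin 3 → ℤ, ∀ n, n ≠ n₀ → R₀ + (L - 2 * R₀) / 2 ≤ ‖x₀ - latticeVec L n‖ := by
  by_cases h : ∃ n₀ : Fin 3 → ℤ, ‖x₀ - latticeVec L n₀‖ < R₀ + (L - 2 * R₀) / 2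
  · obtain ⟨n₀, hn₀⟩ := h
    refine ⟨n₀, fun n hn => ?_⟩
    by_contra hlt
    push Not at hlt
    have hd := le_norm_latticeVec_sub_latticeVec hL.le hn
    have htri : ‖latticeVec L n - latticeVec L n₀‖ ≤ ‖x₀ - latticeVec L n‖ + ‖x₀ - latticeVec L n₀‖ := by
      rw [show latticeVec L n - latticeVec L n₀ = (x₀ - latticeVec L n₀) - (x₀ - latticeVec L n) by abel]
      rw [add_comm]
      exact norm_sub_le _ _
    linarith
  · push Not at h
    exact ⟨0, fun n _ => h n⟩

/-- **Nearest image, local form.** For a profile of range `R₀` (`v(r) = 0` for `r > R₀`) and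
`2R₀ < L`, every point `x₀` has a neighbourhood on which the periodised potential is a single
lattice image: `v^per(x) = v(|x - Ln₀|)` for `x` near `x₀`, with `n₀` independent of `x`.
[cite: LSSY2005, Ch. 2, remark after (2.2)] -/
theorem eventually_periodizedPotential_eq_single (hv : ∀ r, R₀ < r → v r = 0) (h2R : 2 * R₀ < L)
    (hL : 0 < L) (x₀ : Space) :
    ∃ n₀ : Fin 3 → ℤ, ∀ᶠ x in 𝓝 x₀, periodizedPotential v L x = v ‖x - latticeVec L n₀‖ := by
  obtain ⟨n₀, hn₀⟩ := exists_forall_ne_le_norm_sub_latticeVec hL R₀ x₀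
  have hδ : 0 < (L - 2 * R₀) / 2 := by linarith
  refine ⟨n₀, ?_⟩
  filter_upwards [ball_mem_nhds x₀ hδ] with x hx
  unfold periodizedPotential
  refine tsum_eq_single n₀ fun n hn => hv _ ?_
  have h1 := hn₀ n hn
  have h2 : ‖x₀ - latticeVec L n‖ ≤ ‖x - latticeVec L n‖ + dist x x₀ := by
    rw [dist_eq_norm, add_comm]
    calc ‖x₀ - latticeVec L n‖ = ‖(x₀ - x) + (x - latticeVec L n)‖ := by rw [sub_add_sub_cancel]
      _ ≤ ‖x₀ - x‖ + ‖x - latticeVec L n‖ := norm_add_le _ _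
      _ = ‖x - x₀‖ + ‖x - latticeVec L n‖ := by rw [norm_sub_rev]
  have h3 : dist x x₀ < (L - 2 * R₀) / 2 := mem_ball.1 hx
  linarith

/-- **Nearest image, pointwise form**: for `2R₀ < L` the periodised potential of a profile of range
`R₀` is, at every point, one of its lattice images. [cite: LSSY2005, Ch. 2, remark after (2.2)] -/
theorem exists_periodizedPotential_eq_single (hv : ∀ r, R₀ < r → v r = 0) (h2R : 2 * R₀ < L)
    (hL : 0 < L) (x : Space) :
    ∃ n₀ : Fin 3 → ℤ, periodizedPotential v L x = v ‖x - latticeVec L n₀‖ := by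
  obtain ⟨n₀, h⟩ := eventually_periodizedPotential_eq_single hv h2R hL x
  exact ⟨n₀, h.self_of_nhds⟩

/-- For a *finite* profile of range `R₀` and `2R₀ < L`, the periodised potential is finite
everywhere. [folklore] -/
theorem periodizedPotential_ne_top_of_range (hv : ∀ r, R₀ < r → v r = 0) (h2R : 2 * R₀ < L)
    (hL : 0 < L) (hfin : ∀ r, v r ≠ ⊤) (x : Space) : periodizedPotential v L x ≠ ⊤ := by
  obtain ⟨n₀, h⟩ := exists_periodizedPotential_eq_single hv h2R hL x
  rw [h]
  exact hfin _

/-- For a finite profile of range `R₀` and `2R₀ < L`, the periodic interaction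
`∑_{i<j} v^per(xᵢ - xⱼ)` is finite at every configuration. [folklore] -/
theorem periodicInteraction_ne_top_of_range {N : ℕ} (hv : ∀ r, R₀ < r → v r = 0)
    (h2R : 2 * R₀ < L) (hL : 0 < L) (hfin : ∀ r, v r ≠ ⊤) (X : Config N) :
    periodicInteraction v L X ≠ ⊤ := by
  unfold periodicInteraction
  refine ENNReal.sum_ne_top.2 fun i _ => ENNReal.sum_ne_top.2 fun j _ => ?_
  exact periodizedPotential_ne_top_of_range hv h2R hL hfin _

/-- **Smoothness of the periodised potential.** If `x ↦ v(|x|)` is `Cᵏ` on `ℝ³` (real-valued via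
`toReal`), `v` has range `R₀` and `2R₀ < L`, then `x ↦ v^per(x)` is `Cᵏ`: locally it is a single
translate `x ↦ v(|x - Ln₀|)`. [cite: LSSY2005, Ch. 2, remark after (2.2)] -/
theorem contDiff_toReal_periodizedPotential {k : WithTop ℕ∞} (hv : ∀ r, R₀ < r → v r = 0)
    (h2R : 2 * R₀ < L) (hL : 0 < L) (hC : ContDiff ℝ k (fun x : Space => (v ‖x‖).toReal)) :
    ContDiff ℝ k (fun x : Space => (periodizedPotential v L x).toReal) := by
  refine contDiff_iff_contDiffAt.2 fun x₀ => ?_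
  obtain ⟨n₀, h⟩ := eventually_periodizedPotential_eq_single hv h2R hL x₀
  have hg : ContDiff ℝ k (fun x : Space => (v ‖x - latticeVec L n₀‖).toReal) :=
    hC.comp (contDiff_id.sub contDiff_const)
  refine hg.contDiffAt.congr_of_eventuallyEq ?_
  filter_upwards [h] with x hx
  simp only [hx]

/-- The periodic interaction as a real number is the finite sum of the real pair terms (finite
profile of range `R₀`, `2R₀ < L`). [folklore] -/
theorem toReal_periodicInteraction_of_range {N : ℕ} (hv : ∀ r, R₀ < r → v r = 0)
    (h2R : 2 * R₀ < L) (hL : 0 < L) (hfin : ∀ r, v r ≠ ⊤) (X : Config N) :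
    (periodicInteraction v L X).toReal =
      ∑ i : Fin N, ∑ j : Fin N with i < j, (periodizedPotential v L (X i - X j)).toReal := by
  unfold periodicInteraction
  rw [ENNReal.toReal_sum fun i _ => ENNReal.sum_ne_top.2 fun j _ =>
    periodizedPotential_ne_top_of_range hv h2R hL hfin _]
  refine Finset.sum_congr rfl fun i _ => ?_
  exact ENNReal.toReal_sum fun j _ => periodizedPotential_ne_top_of_range hv h2R hL hfin _

/-- **Smoothness of the periodic interaction.** If `x ↦ v(|x|)` is `Cᵏ` on `ℝ³`, `v` is finite of
range `R₀` and `2R₀ < L`, then `X ↦ ∑_{i<j} v^per(xᵢ - xⱼ)` is `Cᵏ` on `(ℝ³)^N` (as a real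
function). [cite: LSSY2005, Ch. 2, remark after (2.2)] -/
theorem contDiff_toReal_periodicInteraction {N : ℕ} {k : WithTop ℕ∞}
    (hv : ∀ r, R₀ < r → v r = 0) (h2R : 2 * R₀ < L) (hL : 0 < L) (hfin : ∀ r, v r ≠ ⊤)
    (hC : ContDiff ℝ k (fun x : Space => (v ‖x‖).toReal)) :
    ContDiff ℝ k (fun X : Config N => (periodicInteraction v L X).toReal) := by
  have hp := contDiff_toReal_periodizedPotential hv h2R hL hC
  have h : (fun X : Config N => (periodicInteraction v L X).toReal) = fun X =>
      ∑ i : Fin N, ∑ j : Fin N with i < j, (periodizedPotential v L (X i - X j)).toReal :=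
    funext fun X => toReal_periodicInteraction_of_range hv h2R hL hfin X
  rw [h]
  refine ContDiff.sum fun i _ => ContDiff.sum fun j _ => ?_
  exact hp.comp ((contDiff_apply ℝ Space i).sub (contDiff_apply ℝ Space j))

/-- The periodic interaction of a finite profile of range `R₀`, `2R₀ < L`, is `ENNReal.ofReal` of
its real version. [folklore] -/
theorem periodicInteraction_eq_ofReal_toReal {N : ℕ} (hv : ∀ r, R₀ < r → v r = 0)
    (h2R : 2 * R₀ < L) (hL : 0 < L) (hfin : ∀ r, v r ≠ ⊤) (X : Config N) :
    periodicInteraction v L X = ENNReal.ofReal (periodicInteraction v L X).toReal :=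
  (ENNReal.ofReal_toReal (periodicInteraction_ne_top_of_range hv h2R hL hfin X)).symm

end Literature.MathematicalPhysics.QuantumManyBody.BoseGas

end
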